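import Summits.CriticalPhenomena.SAWScalingLimit.Theorems.SAWDefectDecoherenceBoundaryClosureRInnerPolygonsBoundaryWalk
import HarnessLib

/-!
# Crux `BoundaryClosureR` (stmt-CriticalPhenomena-14004), line `polygon-parity-squeeze`,
# stub `stub_innerPolygons` (IP): unions of SUPER-HEXAGON tiles of `𝕋` are pinch-free

Landing target:
`Summits/CriticalPhenomena/SAWScalingLimit/Theorems/SAWDefectDecoherenceBoundaryClosureRInnerPolygonsSuperHexagons.lean`
(`--supports stmt-CriticalPhenomena-14004`; building block of the registered stub `stub_innerPolygons`,
FACT 1 of the inner-polygon construction: the bulk of the cell set `K` is a union of super-hexagons).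

The six faces `faceL c 0, …, faceL c 5` round a lattice vertex `c` form the SUPER-HEXAGON of centre
`c` (a regular hexagon of circumradius `1` with sides in the three zigzag directions).  The
super-hexagons centred on the index-`3` sublattice `C = {c | c₀ ≡ c₁ (mod 3)}` TILE the faces of `𝕋`
(every face has exactly one vertex in `C`, `existsUnique_vertex_centre`), and this tiling is
`3`-valent: a vertex off `C` is a corner of exactly three tiles, which own its six faces in three
consecutive PAIRS (`tile_faces_at_vertex_one/two`).  Consequently **every union of tiles is
pinch-free** (`superHexagons_noPinch`): round every vertex there is at most one anticlockwise
`K → non-K` switch — the no-pinch hypothesis of `boundaryWalk_vertexSimple` /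
`boundaryPolygon_isSimpleClosed` — because the tile pattern round a vertex has one of three BLOCK
forms (`tile_pattern`) and block patterns switch off at most once (`blocks_switch_le_one`,
`decide`d); the block form is what the trapezoid gluing of `…InnerPolygonsTrapezoid.lean` consumes.

* `tileFaces S` — the faces of the tiles with centres in `S : Finset (Site 2)` (a `Finset.biUnion`,
  data); `mem_tileFaces_iff` — `F` is a tile face iff one of its vertices is a centre in `S`;
* `faceL_mem_tileFaces_iff` — `faceL y k ∈ tileFaces S ↔ y ∈ S ∨ y + triDir k ∈ S ∨ y + triDir (k+1) ∈ S`;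
* `superHexagons_noPinch` — for `S ⊆ C`, `∀ y, #{k | faceL y k ∈ tileFaces S ∧ faceL y (k+1) ∉ tileFaces S} ≤ 1`.

Sources: folklore (the honeycomb of super-hexagons is the hexagonal tiling dual to the `√3`-sublattice).
No proposition is defined and no named fact is introduced.
-/

noncomputable section

open scoped Classical
open Literature.Probability.LatticeModels
open Literature.Probability.Percolation (triDir)
open Literature.Probability.RandomPlanarGeometry.SAW (site_two_eq_iff)

namespace Summit.CriticalPhenomena.SAWScalingLimit.Theorems.PolygonParitySqueeze.BoundaryWalk

/-- **The faces of the super-hexagon tiles with centres in `S`** (data: a finite union of the six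
faces round each centre). [folklore] -/
def tileFaces (S : Finset (Site 2)) : Finset HexVertex :=
  S.biUnion fun c => (Finset.univ : Finset (Fin 6)).image (faceL c)

/-- A face is a tile face iff one of its vertices is a centre in `S`. [folklore] -/
theorem mem_tileFaces_iff (S : Finset (Site 2)) (F : HexVertex) :
    F ∈ tileFaces S ↔ ∃ c ∈ S, c ∈ hexFaceVertices F := by
  simp only [tileFaces, Finset.mem_biUnion, Finset.mem_image, Finset.mem_univ, true_and]
  constructor
  · rintro ⟨c, hc, k, rfl⟩
    exact ⟨c, hc, (mem_hexFaceVertices_iff c _).2 ⟨k, rfl⟩⟩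
  · rintro ⟨c, hc, hcF⟩
    obtain ⟨k, rfl⟩ := (mem_hexFaceVertices_iff c F).1 hcF
    exact ⟨c, hc, k, rfl⟩

/-- The face `faceL y k` is a tile face iff `y`, `y + triDir k` or `y + triDir (k+1)` is a centre
in `S`. [folklore] -/
theorem faceL_mem_tileFaces_iff (S : Finset (Site 2)) (y : Site 2) (k : Fin 6) :
    faceL y k ∈ tileFaces S ↔ y ∈ S ∨ y + triDir k ∈ S ∨ y + triDir (k + 1) ∈ S := by
  rw [mem_tileFaces_iff]
  simp only [hexFaceVertices_faceL, Finset.mem_insert, Finset.mem_singleton]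
  constructor
  · rintro ⟨c, hc, rfl | rfl | rfl⟩
    · exact Or.inl hc
    · exact Or.inr (Or.inl hc)
    · exact Or.inr (Or.inr hc)
  · rintro (h | h | h)
    · exact ⟨_, h, Or.inl rfl⟩
    · exact ⟨_, h, Or.inr (Or.inl rfl)⟩
    · exact ⟨_, h, Or.inr (Or.inr rfl)⟩

/-- The residue `x₀ - x₁ (mod 3)` of the neighbour `x + triDir k`: it moves by `+1, -1, +1, -1, +1, -1`.
[folklore] -/
theorem sub_triDir_emod (x : Site 2) (k : Fin 6) :
    ((x + triDir k) 0 - (x + triDir k) 1) % 3 = (x 0 - x 1 + ![1, 2, 1, 2, 1, 2] k) % 3 := by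
  fin_cases k <;> simp [triDir] <;> omega

/-- **The tile pattern round a vertex.** For centres on the sublattice `c₀ ≡ c₁ (mod 3)`, the
membership of the six faces round `y` in the tiles is a Boolean pattern `T` of one of three BLOCK
forms: constant (`y` is a centre: it owns all six faces), or paired `T 0 = T 1, T 2 = T 3, T 4 = T 5`
(residue `1`: the corner `y` of the three tiles centred at `y + triDir 1, 3, 5`), or paired
`T 5 = T 0, T 1 = T 2, T 3 = T 4` (residue `2`: tiles centred at `y + triDir 0, 2, 4`). [folklore] -/
theorem tile_pattern (S : Finset (Site 2)) (hS : ∀ c ∈ S, (c 0 - c 1) % 3 = 0) (y : Site 2) :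
    ∃ T : Fin 6 → Bool, ((∀ k, T k = T 0) ∨ (T 0 = T 1 ∧ T 2 = T 3 ∧ T 4 = T 5) ∨
      (T 5 = T 0 ∧ T 1 = T 2 ∧ T 3 = T 4)) ∧ ∀ k : Fin 6, faceL y k ∈ tileFaces S ↔ T k = true := by
  have key : ∀ k : Fin 6, faceL y k ∈ tileFaces S ↔ y ∈ S ∨ y + triDir k ∈ S ∨ y + triDir (k + 1) ∈ S :=
    fun k => faceL_mem_tileFaces_iff S y k
  have hres : ∀ k : Fin 6, y + triDir k ∈ S → (y 0 - y 1 + ![1, 2, 1, 2, 1, 2] k) % 3 = 0 := by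
    intro k hk
    have := hS _ hk
    rwa [sub_triDir_emod] at this
  have hy3 : (y 0 - y 1) % 3 = 0 ∨ (y 0 - y 1) % 3 = 1 ∨ (y 0 - y 1) % 3 = 2 := by omega
  rcases hy3 with h0 | h1 | h2
  · -- `y` is a centre
    have hnb : ∀ k : Fin 6, y + triDir k ∉ S := by
      intro k hk
      have := hres k hk
      fin_cases k <;> simp at this <;> omega
    refine ⟨fun _ => decide (y ∈ S), Or.inl fun _ => rfl, fun k => ?_⟩
    rw [key]
    simp only [decide_eq_true_eq]
    exact ⟨fun h => h.elim id fun h => h.elim (fun h => absurd h (hnb _)) fun h => absurd h (hnb _), Or.inl⟩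
  · -- residue `1`
    have hyS : y ∉ S := fun h => by have := hS _ h; omega
    have hnb : ∀ k : Fin 6, y + triDir k ∈ S → k = 1 ∨ k = 3 ∨ k = 5 := by
      intro k hk
      have := hres k hk
      fin_cases k <;> simp at this ⊢ <;> omega
    refine ⟨![decide (y + triDir 1 ∈ S), decide (y + triDir 1 ∈ S), decide (y + triDir 3 ∈ S),
      decide (y + triDir 3 ∈ S), decide (y + triDir 5 ∈ S), decide (y + triDir 5 ∈ S)],
      Or.inr (Or.inl ⟨rfl, rfl, rfl⟩), fun k => ?_⟩
    rw [key]
    fin_cases k <;> simp [hyS] <;>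
      (intro h; exfalso; rcases hnb _ h with h' | h' | h' <;> simp at h')
  · -- residue `2`
    have hyS : y ∉ S := fun h => by have := hS _ h; omega
    have hnb : ∀ k : Fin 6, y + triDir k ∈ S → k = 0 ∨ k = 2 ∨ k = 4 := by
      intro k hk
      have := hres k hk
      fin_cases k <;> simp at this ⊢ <;> omega
    refine ⟨![decide (y + triDir 0 ∈ S), decide (y + triDir 2 ∈ S), decide (y + triDir 2 ∈ S),
      decide (y + triDir 4 ∈ S), decide (y + triDir 4 ∈ S), decide (y + triDir 0 ∈ S)],
      Or.inr (Or.inr ⟨rfl, rfl, rfl⟩), fun k => ?_⟩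
    rw [key]
    fin_cases k <;> simp [hyS] <;>
      (intro h; exfalso; rcases hnb _ h with h' | h' | h' <;> simp at h')

/-- **Block patterns switch off at most once** (`decide`d): a `6`-cycle of Booleans of one of the
three block forms has at most one anticlockwise `true → false` switch. [folklore] -/
theorem blocks_switch_le_one (T : Fin 6 → Bool)
    (hT : (∀ k, T k = T 0) ∨ (T 0 = T 1 ∧ T 2 = T 3 ∧ T 4 = T 5) ∨ (T 5 = T 0 ∧ T 1 = T 2 ∧ T 3 = T 4)) :
    (Finset.univ.filter fun k : Fin 6 => T k = true ∧ T (k + 1) = false).card ≤ 1 := by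
  revert T
  decide

/-- **Unions of super-hexagon tiles are pinch-free**: if every centre of `S` lies on the sublattice
`c₀ ≡ c₁ (mod 3)`, then round every vertex `y` there is at most one anticlockwise switch from a tile
face to a non-tile face among `faceL y 0, …, faceL y 5` — the no-pinch hypothesis of
`boundaryWalk_vertexSimple`. [folklore] -/
theorem superHexagons_noPinch : ∀ (S : Finset (Site 2)), (∀ c ∈ S, (c 0 - c 1) % 3 = 0) → ∀ y : Site 2, (Finset.univ.filter fun k : Fin 6 => faceL y k ∈ tileFaces S ∧ faceL y (k + 1) ∉ tileFaces S).card ≤ 1 := by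
  intro S hS y
  obtain ⟨T, hT, hf⟩ := tile_pattern S hS y
  have hb := blocks_switch_le_one T hT
  convert hb using 2
  ext k
  simp only [Finset.mem_filter, Finset.mem_univ, true_and, hf]
  simp

end Summit.CriticalPhenomena.SAWScalingLimit.Theorems.PolygonParitySqueeze.BoundaryWalk

end
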